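import Literature.AnabelianGeometry.EtaleTheta.TemperedFrobenioidProps
import Literature.AnabelianGeometry.EtaleTheta.TemperedFrobenioidToy
import Mathlib.CategoryTheory.SingleObj
import HarnessLib

/-!
# [EtTh] §3: the typed clauses `Thm37_i`, `Thm37_iii`, `Remark362`, `Remark372` of `TemperedFrobenioidProps.lean`
# are SCHEMAS in their free vocabulary parameters — universal closures refuted (FACT-LIST F-0743, F-1312,
# F-1311, F-1397)

S. Mochizuki, *The étale theta function and its Frobenioid-theoretic manifestations*, Publ. RIMS **45** (2009)
[EtTh], §3: Theorem 3.7 (i)/(iii) PDF pp. 79–80, Remark 3.6.2 p. 78, Remark 3.7.2 p. 80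
[cite: MochizukiEtTh2009, Thm 3.7 p.79] [cite: MochizukiEtTh2009, Rmk 3.6.2 p.78] [cite: MochizukiEtTh2009, Rmk 3.7.2 p.80].

PROOF-ONLY companion (no definitions, no instances) of abc-iut-L2-t3's statements file
`TemperedFrobenioidProps.lean`, abc-iut cell seat abc-iut-f-049 (F fact-proving wave; rows F-0743 `Thm37_i`,
F-1312 `Thm37_iii`, F-1311 `Remark362`, F-1397 `Remark372`, all `preparatory`, `parametrised`).

WHY THE CLOSURES ARE FALSE.  The statements file types the [FrdI]/[FrdII] notions that were not in the tree at
typing time through FREE VOCABULARY PARAMETERS: the hypothesis vocabulary `F : FrobenioidFacade D` (fields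
`IsOfUnitProfiniteType`, `IsOfModelType`, …, `AutActionFactorsThroughCnst`, `AutActionFaithfulCnst` — arbitrary
predicates), the category vocabulary `VD : FrdICatStub D` (`IsStrictlyRational` an arbitrary predicate), and, in
`Remark372`, an ARBITRARY category `D₀` standing for the connected temperoid `B^temp(X^log)⁰`.  A statement
quantified over an arbitrary predicate is refuted by the predicate `⊥`:

* `exists_facade_not_thm37_i`, `exists_facade_not_thm37_iii` — for EVERY tempered Frobenioid `C₀` some facade
  violates `Thm37_i` (clause "of model type" := `⊥`) and `Thm37_iii` (clause "the action factors through
  `Aut_{D^cnst}(A^cnst)`" := `⊥`, at the object `(A_D, 0)`); hence `not_forall_thm37_i`, `not_forall_thm37_iii`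
  (the interface IS inhabited: abc-iut-L2-t3's `Toy.temperedFrobenioid`, `TemperedFrobenioidToy.lean`);
* `not_forall_remark362` — the Toy re-typed over the category vocabulary with `IsStrictlyRational := ⊥`;
* `not_isSlim_singleObj`, `not_remark372_singleObj`, `not_forall_remark372` — the one-object category of a
  commutative group with a nontrivial element is not slim (multiplication by that element is a nontrivial
  automorphism of every `D_A → D`), so `Remark372 D₀ = (D₀ slim ∧ FSM ∧ FSMFF)` fails at `D₀ = B(ℤ)`.

INSTANCE FORMS (the statements print makes, at the [EtTh] data) are in the tree and are CITED, not restated: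
Thm 3.7 (i) tree-vocabulary clauses `TemperedFrobenioid.thm37_i_treeClauses_of_isFrobenioid` /
`…_treeCatVocab_of_isMonoidOn` (`Discharge/Sec3Thm37Holds.lean`, abc-iut-L6-t13), the unit clauses
(`Discharge/Sec3Thm37UnitProfinite.lean`, `Sec3Thm37Units.lean`), the model-type clause
(`Discharge/Sec3Thm37ModelType.lean`); Thm 3.7 (iii) at the instantiated facade `thm37_iii_withCnst`
(`Discharge/Sec3Thm37Cnst.lean`, `Sec3Thm37CnstFacade.lean`); Rmk 3.7.2's FSM-type clause for coset temperoids
`CosetCat.isOfFSMType` ([FrdII] Ex. 1.3 (i), `SemiGraphs/CosetCategoriesFSM.lean`), its slimness clause being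
[SemiAnbd] Ex. 3.10 (consumed BY NAME as a hypothesis on the base in the cone).  So these rows are admissible AT
NAMED INSTANCES ONLY (FACT-LIST class «universal-closure REFUTED / schema; instance forms PROVED or cited»).
HONEST FRAMING: bookkeeping about the typing; a refuted closure says nothing about [EtTh], whose statements are
the instance forms; nothing here bears on [IUTchIII] Cor. 3.12.
-/

namespace Literature.AnabelianGeometry.EtaleTheta

open CategoryTheory Opposite Literature.AlgebraicGeometry.Frobenioids

universe u₀ v₀ u v w

namespace TemperedFrobenioid

section Facade

variable {D₀ : Type u₀} [Category.{v₀} D₀] {V : FrdIMonoidStub.{w}}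
  {T : RealifiedDivisorMonoids (D₀ := D₀) V} {D : Type u} [Category.{v} D] {VD : FrdICatStub.{u, v, w} D}
  (C₀ : TemperedFrobenioid T D VD)

/-- **F-0743 is a schema in the facade**: for every tempered Frobenioid `C₀` there is a hypothesis vocabulary
`F` (clause "of model type" read as `⊥`) with `¬ Thm37_i C₀ F`. [cite: MochizukiEtTh2009, Thm 3.7 p.79] -/
theorem exists_facade_not_thm37_i : ∃ F : FrobenioidFacade.{u, v, w} D, ¬ C₀.Thm37_i F :=
  ⟨⟨fun _ => True, fun _ => False, fun _ => True, fun _ => True, fun _ => True, fun _ _ => True,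
      fun _ _ => True⟩,
    fun h => h.2.2.2.1⟩

/-- **F-1312 is a schema in the facade**: for every tempered Frobenioid `C₀` there is a hypothesis vocabulary
`F` (clause "the natural action of `Aut_C(A)` on `O^▷(A)`, `O^×(A)` factors through `Aut_{D^cnst}(A^cnst)`" read
as `⊥`) with `¬ Thm37_iii C₀ F` (evaluate at the object `(A_D, 0)`). [cite: MochizukiEtTh2009, Thm 3.7 p.79] -/
theorem exists_facade_not_thm37_iii : ∃ F : FrobenioidFacade.{u, v, w} D, ¬ C₀.Thm37_iii F :=
  ⟨⟨fun _ => True, fun _ => True, fun _ => True, fun _ => True, fun _ => True, fun _ _ => False,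
      fun _ _ => True⟩,
    fun h => C₀.isConnected.is_nonempty.elim fun A => h.1 ⟨A, 1⟩⟩

end Facade

/-- **The universal closure of F-0743 is false**: the tempered-Frobenioid interface is inhabited (abc-iut-L2-t3's
degenerate `Toy.temperedFrobenioid` over the one-object base) and at any inhabitant some facade violates
`Thm37_i`. [cite: MochizukiEtTh2009, Thm 3.7 p.79] -/
theorem not_forall_thm37_i :
    ¬ ∀ (D₀ : Type) (_ : Category.{0} D₀) (V : FrdIMonoidStub.{0}) (T : RealifiedDivisorMonoids (D₀ := D₀) V)
        (D : Type) (_ : Category.{0} D) (VD : FrdICatStub.{0, 0, 0} D) (C₀ : TemperedFrobenioid T D VD)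
        (F : FrobenioidFacade.{0, 0, 0} D), C₀.Thm37_i F := fun h =>
  (exists_facade_not_thm37_i Toy.temperedFrobenioid).elim fun F hF => hF (h _ _ _ _ _ _ _ _ F)

/-- **The universal closure of F-1312 is false** (same inhabitant, facade with the factorisation clause `⊥`).
[cite: MochizukiEtTh2009, Thm 3.7 p.79] -/
theorem not_forall_thm37_iii :
    ¬ ∀ (D₀ : Type) (_ : Category.{0} D₀) (V : FrdIMonoidStub.{0}) (T : RealifiedDivisorMonoids (D₀ := D₀) V)
        (D : Type) (_ : Category.{0} D) (VD : FrdICatStub.{0, 0, 0} D) (C₀ : TemperedFrobenioid T D VD)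
        (F : FrobenioidFacade.{0, 0, 0} D), C₀.Thm37_iii F := fun h =>
  (exists_facade_not_thm37_iii Toy.temperedFrobenioid).elim fun F hF => hF (h _ _ _ _ _ _ _ _ F)

/-- **The universal closure of F-1311 is false**: `Remark362`'s first conjunct "`Φ^{bs-fld}` is strictly rational"
is the FREE category-vocabulary predicate `VD.IsStrictlyRational`; re-typing the Toy inhabitant over the
vocabulary with `IsStrictlyRational := ⊥` (the interface `TemperedFrobenioid` reads only `IsDivisorialOn`)
violates it. [cite: MochizukiEtTh2009, Rmk 3.6.2 p.78] -/
theorem not_forall_remark362 :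
    ¬ ∀ (D₀ : Type) (_ : Category.{0} D₀) (V : FrdIMonoidStub.{0}) (T : RealifiedDivisorMonoids (D₀ := D₀) V)
        (D : Type) (_ : Category.{0} D) (VD : FrdICatStub.{0, 0, 0} D) (C₀ : TemperedFrobenioid T D VD),
        C₀.Remark362 := fun h =>
  (h (Discrete PUnit.{1}) inferInstance Toy.monoidVocab Toy.realified (Discrete PUnit.{1}) inferInstance
    ⟨fun _ => True, fun _ => True, fun _ => False⟩
    { isConnected := Toy.temperedFrobenioid.isConnected
      isTotallyEpimorphic := Toy.temperedFrobenioid.isTotallyEpimorphic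
      base := Toy.temperedFrobenioid.base
      Φ := Toy.temperedFrobenioid.Φ
      isGroupSaturated := Toy.temperedFrobenioid.isGroupSaturated
      isPerfFactorial := Toy.temperedFrobenioid.isPerfFactorial
      isDivisorialOn := trivial
      isMonoprime_bsFld := Toy.temperedFrobenioid.isMonoprime_bsFld
      exists_FΛ_div_ne := Toy.temperedFrobenioid.exists_FΛ_div_ne }).1

/-! ### Remark 3.7.2: `D₀` arbitrary -/

/-- The one-object category of a commutative group with a nontrivial element `g` is NOT slim: multiplication by
`g` is a nontrivial automorphism of every forgetful functor `D_A → D` ([FrdI] §0 p. 14).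
[cite: MochizukiFrdI2008, §0 p.14] -/
theorem not_isSlim_singleObj {G : Type u} [CommGroup G] (g : G) (hg : g ≠ 1) : ¬ IsSlim (SingleObj G) := by
  intro h
  let A : SingleObj G := SingleObj.star G
  let α : Over.forget A ≅ Over.forget A :=
    NatIso.ofComponents (fun U => Groupoid.isoEquivHom _ _ |>.symm (show U.left ⟶ U.left from g)) (by
      intro U U' m
      show m.left ≫ (g : U'.left ⟶ U'.left) = (g : U.left ⟶ U.left) ≫ m.left
      rw [SingleObj.comp_as_mul, SingleObj.comp_as_mul, mul_comm])
  have hα : α = Iso.refl _ := h.isRigid_forget A α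
  have h1 : (g : A ⟶ A) = 𝟙 A := by
    have := congrArg (fun i : Over.forget A ≅ Over.forget A => i.hom.app (Over.mk (𝟙 A))) hα
    exact this
  exact hg (h1.trans (SingleObj.id_as_one G A))

/-- **F-1397 is a schema in `D₀`**: `Remark372 D₀` ("`D₀` is slim and of FSM-, hence FSMFF-, type") FAILS at the
one-object category of any commutative group with a nontrivial element. [cite: MochizukiEtTh2009, Rmk 3.7.2 p.80] -/
theorem not_remark372_singleObj {G : Type u} [CommGroup G] (g : G) (hg : g ≠ 1) :
    ¬ Remark372 (SingleObj G) := fun h =>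
  not_isSlim_singleObj g hg h.1

/-- **The universal closure of F-1397 is false** (witness `D₀ = B(ℤ)`); the printed statement is the instance at
the connected temperoid `D₀ = B^temp(X^log)⁰` ([SemiAnbd] Ex. 3.10 slimness; [FrdII] Ex. 1.3 (i) FSM-type,
`CosetCat.isOfFSMType`). [cite: MochizukiEtTh2009, Rmk 3.7.2 p.80] -/
theorem not_forall_remark372 : ¬ ∀ (D₀ : Type) (_ : Category.{0} D₀), Remark372 D₀ := fun h =>
  not_remark372_singleObj (G := Multiplicative ℤ) (Multiplicative.ofAdd 1)
    (fun h1 => one_ne_zero (Multiplicative.ofAdd.injective (h1.trans ofAdd_zero.symm))) (h _ _)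

end TemperedFrobenioid

end Literature.AnabelianGeometry.EtaleTheta
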